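import Summits.FinalStateConjecture.FinalStateConjecture.Theorems.EIHFluxBalanceInertialRecessionVirialFamily

/-!
# Route EIHFluxBalance — crux `InertialRecession`, abstract endgame for general `N`:
# keys of the frozen-block hierarchy — level and parent are constant along a node's block

Helper file for the crux `stmt-FinalStateConjecture-10166` (virial route; `InertialRecession_seat0_session8_note.md` §A).
Pure combinatorics, GENERIC over a qualification predicate `Q B ℓ s` ("`B` qualifies at level `ℓ` with respect to the
configuration of step `s`"): the family of step `i` is `{B | B ⊂ 𝒦, B ≠ ∅, ∃ ℓ ∈ [k₀, L), Q B ℓ (bs ℓ i)}` with the block start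
`bs ℓ i = 2^{ℓ−k₀} (i / 2^{ℓ−k₀})`, and `lev i B` is the largest qualifying level. Then along the level-`(lev i B)` block of `i`:

* `mem_family_and_lev_eq` — `B` stays in the family with the same level (nested dyadic grids);
* `ssupersets_eq` — if strict superset nodes live at strictly coarser levels (`hsep`, supplied by geometry), the strict supersets of
  `B` in the family do not change, hence (`parent_eq`) neither does a parent computed from them;
* `key_block` — the packaged BLOCK PROPERTY of the key `(lev i B − k₀, bs (lev i B) i)` consumed by `abs_sum_alive_le`.
-/

noncomputable section

open Finset

namespace Summit.FinalStateConjecture.FinalStateConjecture.Theorems.SublinearIsFree.Virial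

open Literature.Geometry.Lorentzian

variable {ι : Type*} [DecidableEq ι]

section Keys

variable {𝒦 : Finset ι} {Q : Finset ι → ℕ → ℕ → Prop} {F : ℕ → Finset (Finset ι)} {lev : ℕ → Finset ι → ℕ}
  {k₀ L : ℕ}

omit [DecidableEq ι] in
/-- **Level constancy along the block.** See the module docstring. [folklore] -/
theorem mem_family_and_lev_eq
    (hFdef : ∀ i B, B ∈ F i ↔ B ⊂ 𝒦 ∧ B.Nonempty ∧ ∃ ℓ, k₀ ≤ ℓ ∧ ℓ < L ∧ Q B ℓ (2 ^ (ℓ - k₀) * (i / 2 ^ (ℓ - k₀))))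
    (hlev : ∀ i, ∀ B ∈ F i, k₀ ≤ lev i B ∧ lev i B < L ∧ Q B (lev i B) (2 ^ (lev i B - k₀) * (i / 2 ^ (lev i B - k₀))))
    (hlevmax : ∀ i, ∀ B ∈ F i, ∀ ℓ, k₀ ≤ ℓ → ℓ < L → Q B ℓ (2 ^ (ℓ - k₀) * (i / 2 ^ (ℓ - k₀))) → ℓ ≤ lev i B)
    {i : ℕ} {B : Finset ι} (hB : B ∈ F i) {i' : ℕ}
    (h1 : 2 ^ (lev i B - k₀) * (i / 2 ^ (lev i B - k₀)) ≤ i')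
    (h2 : i' < 2 ^ (lev i B - k₀) * (i / 2 ^ (lev i B - k₀)) + 2 ^ (lev i B - k₀)) :
    B ∈ F i' ∧ lev i' B = lev i B := by
  obtain ⟨hsub, hne, -⟩ := (hFdef i B).mp hB
  obtain ⟨hk, hL, hQ⟩ := hlev i B hB
  -- at every level `ℓ ≥ lev i B` the block starts of `i` and `i'` agree
  have hbs : ∀ ℓ, lev i B ≤ ℓ → 2 ^ (ℓ - k₀) * (i' / 2 ^ (ℓ - k₀)) = 2 ^ (ℓ - k₀) * (i / 2 ^ (ℓ - k₀)) :=
    fun ℓ hℓ ↦ blockStart_nested (by omega) h1 h2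
  have hB' : B ∈ F i' := by
    rw [hFdef]
    refine ⟨hsub, hne, lev i B, hk, hL, ?_⟩
    rw [hbs _ le_rfl]
    exact hQ
  refine ⟨hB', le_antisymm ?_ ?_⟩
  · -- `lev i' B ≤ lev i B`: otherwise `lev i' B > lev i B` qualifies at `i` too
    by_contra hlt
    push Not at hlt
    obtain ⟨hk', hL', hQ'⟩ := hlev i' B hB'
    rw [hbs _ hlt.le] at hQ'
    have := hlevmax i B hB _ hk' hL' hQ'
    omega
  · exact hlevmax i' B hB' _ hk hL (by rw [hbs _ le_rfl]; exact hQ)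

/-- **Strict supersets do not change along the block**, given that strict superset nodes live at strictly coarser levels.
[folklore] -/
theorem ssupersets_eq
    (hFdef : ∀ i B, B ∈ F i ↔ B ⊂ 𝒦 ∧ B.Nonempty ∧ ∃ ℓ, k₀ ≤ ℓ ∧ ℓ < L ∧ Q B ℓ (2 ^ (ℓ - k₀) * (i / 2 ^ (ℓ - k₀))))
    (hlev : ∀ i, ∀ B ∈ F i, k₀ ≤ lev i B ∧ lev i B < L ∧ Q B (lev i B) (2 ^ (lev i B - k₀) * (i / 2 ^ (lev i B - k₀))))
    (hlevmax : ∀ i, ∀ B ∈ F i, ∀ ℓ, k₀ ≤ ℓ → ℓ < L → Q B ℓ (2 ^ (ℓ - k₀) * (i / 2 ^ (ℓ - k₀))) → ℓ ≤ lev i B)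
    (hsep : ∀ i (B B' : Finset ι) (ℓ ℓ' : ℕ), B.Nonempty → B ⊂ B' → k₀ ≤ ℓ → k₀ ≤ ℓ' →
      Q B ℓ (2 ^ (ℓ - k₀) * (i / 2 ^ (ℓ - k₀))) → Q B' ℓ' (2 ^ (ℓ' - k₀) * (i / 2 ^ (ℓ' - k₀))) → ℓ + 1 ≤ ℓ')
    {i : ℕ} {B : Finset ι} (hB : B ∈ F i) {i' : ℕ}
    (h1 : 2 ^ (lev i B - k₀) * (i / 2 ^ (lev i B - k₀)) ≤ i')
    (h2 : i' < 2 ^ (lev i B - k₀) * (i / 2 ^ (lev i B - k₀)) + 2 ^ (lev i B - k₀)) :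
    (F i').filter (fun B' ↦ B ⊂ B') = (F i).filter (fun B' ↦ B ⊂ B') := by
  obtain ⟨-, hne, -⟩ := (hFdef i B).mp hB
  obtain ⟨hBi', hlevi'⟩ := mem_family_and_lev_eq hFdef hlev hlevmax hB h1 h2
  have hbs : ∀ ℓ, lev i B ≤ ℓ → 2 ^ (ℓ - k₀) * (i' / 2 ^ (ℓ - k₀)) = 2 ^ (ℓ - k₀) * (i / 2 ^ (ℓ - k₀)) :=
    fun ℓ hℓ ↦ blockStart_nested (by omega) h1 h2
  -- `B` qualifies at `lev i B` at both steps
  have hQi : Q B (lev i B) (2 ^ (lev i B - k₀) * (i / 2 ^ (lev i B - k₀))) := (hlev i B hB).2.2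
  have hQi' : Q B (lev i B) (2 ^ (lev i B - k₀) * (i' / 2 ^ (lev i B - k₀))) := by rw [hbs _ le_rfl]; exact hQi
  have hk : k₀ ≤ lev i B := (hlev i B hB).1
  ext B'
  simp only [Finset.mem_filter]
  constructor
  · rintro ⟨hB'i', hBB'⟩
    obtain ⟨hsub', hne', ℓ', hk', hL', hQ'⟩ := (hFdef i' B').mp hB'i'
    have hℓ' : lev i B + 1 ≤ ℓ' := hsep i' B B' (lev i B) ℓ' hne hBB' hk hk' hQi' hQ'
    refine ⟨(hFdef i B').mpr ⟨hsub', hne', ℓ', hk', hL', ?_⟩, hBB'⟩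
    rw [← hbs ℓ' (by omega)]
    exact hQ'
  · rintro ⟨hB'i, hBB'⟩
    obtain ⟨hsub', hne', ℓ', hk', hL', hQ'⟩ := (hFdef i B').mp hB'i
    have hℓ' : lev i B + 1 ≤ ℓ' := hsep i B B' (lev i B) ℓ' hne hBB' hk hk' hQi hQ'
    refine ⟨(hFdef i' B').mpr ⟨hsub', hne', ℓ', hk', hL', ?_⟩, hBB'⟩
    rw [hbs ℓ' (by omega)]
    exact hQ'

/-- **Parents are constant along the block** for any parent map that only sees the strict supersets. [folklore] -/
theorem parent_eq
    (hFdef : ∀ i B, B ∈ F i ↔ B ⊂ 𝒦 ∧ B.Nonempty ∧ ∃ ℓ, k₀ ≤ ℓ ∧ ℓ < L ∧ Q B ℓ (2 ^ (ℓ - k₀) * (i / 2 ^ (ℓ - k₀))))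
    (hlev : ∀ i, ∀ B ∈ F i, k₀ ≤ lev i B ∧ lev i B < L ∧ Q B (lev i B) (2 ^ (lev i B - k₀) * (i / 2 ^ (lev i B - k₀))))
    (hlevmax : ∀ i, ∀ B ∈ F i, ∀ ℓ, k₀ ≤ ℓ → ℓ < L → Q B ℓ (2 ^ (ℓ - k₀) * (i / 2 ^ (ℓ - k₀))) → ℓ ≤ lev i B)
    (hsep : ∀ i (B B' : Finset ι) (ℓ ℓ' : ℕ), B.Nonempty → B ⊂ B' → k₀ ≤ ℓ → k₀ ≤ ℓ' →
      Q B ℓ (2 ^ (ℓ - k₀) * (i / 2 ^ (ℓ - k₀))) → Q B' ℓ' (2 ^ (ℓ' - k₀) * (i / 2 ^ (ℓ' - k₀))) → ℓ + 1 ≤ ℓ')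
    (parOf : Finset (Finset ι) → Finset ι → Finset ι)
    (hparOf : ∀ (𝒩 𝒩' : Finset (Finset ι)) (A : Finset ι),
      𝒩.filter (fun B ↦ A ⊂ B) = 𝒩'.filter (fun B ↦ A ⊂ B) → parOf 𝒩 A = parOf 𝒩' A)
    {i : ℕ} {B : Finset ι} (hB : B ∈ F i) {i' : ℕ}
    (h1 : 2 ^ (lev i B - k₀) * (i / 2 ^ (lev i B - k₀)) ≤ i')
    (h2 : i' < 2 ^ (lev i B - k₀) * (i / 2 ^ (lev i B - k₀)) + 2 ^ (lev i B - k₀)) :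
    parOf (F i') B = parOf (F i) B :=
  hparOf _ _ _ (ssupersets_eq hFdef hlev hlevmax hsep hB h1 h2)

/-- **The block property of the key** `(lev i B − k₀, bs (lev i B) i)`, in the form consumed by `abs_sum_alive_le` (for the set
`B` and the alive steps `{i < n | B ∈ F i}`). [folklore] -/
theorem key_block
    (hFdef : ∀ i B, B ∈ F i ↔ B ⊂ 𝒦 ∧ B.Nonempty ∧ ∃ ℓ, k₀ ≤ ℓ ∧ ℓ < L ∧ Q B ℓ (2 ^ (ℓ - k₀) * (i / 2 ^ (ℓ - k₀))))
    (hlev : ∀ i, ∀ B ∈ F i, k₀ ≤ lev i B ∧ lev i B < L ∧ Q B (lev i B) (2 ^ (lev i B - k₀) * (i / 2 ^ (lev i B - k₀))))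
    (hlevmax : ∀ i, ∀ B ∈ F i, ∀ ℓ, k₀ ≤ ℓ → ℓ < L → Q B ℓ (2 ^ (ℓ - k₀) * (i / 2 ^ (ℓ - k₀))) → ℓ ≤ lev i B)
    (B : Finset ι) (n : ℕ) :
    ∀ i ∈ (range n).filter (fun i ↦ B ∈ F i),
      2 ^ (lev i B - k₀) * (i / 2 ^ (lev i B - k₀)) ≤ i ∧
      i < 2 ^ (lev i B - k₀) * (i / 2 ^ (lev i B - k₀)) + 2 ^ (lev i B - k₀) ∧
      ∀ i', i' < n → 2 ^ (lev i B - k₀) * (i / 2 ^ (lev i B - k₀)) ≤ i' →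
        i' < 2 ^ (lev i B - k₀) * (i / 2 ^ (lev i B - k₀)) + 2 ^ (lev i B - k₀) →
        i' ∈ (range n).filter (fun i ↦ B ∈ F i) ∧
        (lev i' B - k₀, 2 ^ (lev i' B - k₀) * (i' / 2 ^ (lev i' B - k₀))) =
          (lev i B - k₀, 2 ^ (lev i B - k₀) * (i / 2 ^ (lev i B - k₀))) := by
  intro i hi
  obtain ⟨-, hB⟩ := Finset.mem_filter.mp hi
  refine ⟨blockStart_le _ _, lt_blockStart_add _ _, fun i' hi'n h1 h2 ↦ ?_⟩
  obtain ⟨hB', hlev'⟩ := mem_family_and_lev_eq hFdef hlev hlevmax hB h1 h2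
  refine ⟨Finset.mem_filter.mpr ⟨Finset.mem_range.mpr hi'n, hB'⟩, ?_⟩
  rw [hlev', blockStart_nested le_rfl h1 h2]

end Keys

/-- Registered one-line form of `key_block` (block property of the key of a node). [folklore] -/
theorem key_block_of_family : open Finset in ∀ {ι : Type*} [DecidableEq ι] {𝒦 : Finset ι} {Q : Finset ι → ℕ → ℕ → Prop} {F : ℕ → Finset (Finset ι)} {lev : ℕ → Finset ι → ℕ} {k₀ L : ℕ}, (∀ i B, B ∈ F i ↔ B ⊂ 𝒦 ∧ B.Nonempty ∧ ∃ ℓ, k₀ ≤ ℓ ∧ ℓ < L ∧ Q B ℓ (2 ^ (ℓ - k₀) * (i / 2 ^ (ℓ - k₀)))) → (∀ i, ∀ B ∈ F i, k₀ ≤ lev i B ∧ lev i B < L ∧ Q B (lev i B) (2 ^ (lev i B - k₀) * (i / 2 ^ (lev i B - k₀)))) → (∀ i, ∀ B ∈ F i, ∀ ℓ, k₀ ≤ ℓ → ℓ < L → Q B ℓ (2 ^ (ℓ - k₀) * (i / 2 ^ (ℓ - k₀))) → ℓ ≤ lev i B) → ∀ (B : Finset ι) (n : ℕ), ∀ i ∈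 (range n).filter (fun i ↦ B ∈ F i), 2 ^ (lev i B - k₀) * (i / 2 ^ (lev i B - k₀)) ≤ i ∧ i < 2 ^ (lev i B - k₀) * (i / 2 ^ (lev i B - k₀)) + 2 ^ (lev i B - k₀) ∧ ∀ i', i' < n → 2 ^ (lev i B - k₀) * (i / 2 ^ (lev i B - k₀)) ≤ i' → i' < 2 ^ (lev i B - k₀) * (i / 2 ^ (lev i B - k₀)) + 2 ^ (lev i B - k₀) → i' ∈ (range n).filter (fun i ↦ B ∈ F i) ∧ (lev i' B - k₀, 2 ^ (lev i' B - k₀) * (i' / 2 ^ (lev i' B - k₀))) = (lev i B - k₀, 2 ^ (lev i B - k₀) * (i / 2 ^ (lev i B - k₀))) :=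
  fun hFdef hlev hlevmax B n ↦ key_block hFdef hlev hlevmax B n

end Summit.FinalStateConjecture.FinalStateConjecture.Theorems.SublinearIsFree.Virial

end
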